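import Literature.NumberTheory.ConnesConsani2021.EpsSlopeTailFrame
import Literature.NumberTheory.ConnesConsani2021.EpsSlopeFrobeniusBridge
import Literature.NumberTheory.ConnesConsani2021.CosTransformCalculus
import HarnessLib

/-!
# Connes–Consani 2021, §5 eq. (99): the analytic continuation `ξ_n^{an}` of the prolate vectors past
# the band edge and the identity `η_n = λ(n) ξ_n^{an}` on `[1, ∞)` (PROVED)

RH-FREE corpus literature (label, line 1): real analysis of prolate spheroidal wave functions of
bandwidth `2π` (a linear ODE with a regular-singular point); nothing in this file mentions `ζ`, the
critical strip or RH, and nothing here bears on the truth of RH.  bears_on (cell rh-crit, corpus C1):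
tooling for the apex input (B) / the numerical side of route «ConnesConsaniSemilocal» items K2
`DensitySlope` (stmt 19308) and K3 (stmt 19306, the deferred in-kernel (E-a) certificate, whose outer
argument `ρx ∈ [1,2]` needs `η̃_n` past `1`).

Source: A. Connes, C. Consani, *Weil positivity and trace formula, the archimedean place*, Selecta
Math. (N.S.) 27 (2021) 77 = arXiv:2006.13771 [bib `ConnesConsani2021`], §5 after Prop. 5.3 (= arXiv
Prop. 30), arXiv PDF p. 32 (chunk p0020:L69–L78; LaTeX source ll. 1348–1361): "When implementing
(98) in a computer program, it is convenient to use the function `ξ_n^{an}` which is the analytic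
continuation of `ξ_n`.  By (74) one has `η_n = λ(n) ξ_n^{an}`, thus for `x ∈ [1,∞)` one derives
`ζ_n(x) = η_n(x)/√(1−λ(n)²) = (λ(n)/√(1−λ(n)²)) ξ_n^{an}(x)`.  Combining this with Proposition 5.3,
one obtains the equality `Qε(ρ) = Σ λ(n)²(1−λ(n)²)⁻¹ C_n` where … Using the equality `D_u f(x) =
x f′(x)` one gets the following formula for `C_n`
(99) `C_n = ρ^{1/2}∫_{ρ⁻¹}^1 x(ξ_n^{an})′(x)·ρx(ξ_n^{an})′(ρx)dx + ρ^{-3/2}(ξ_n^{an})′(ρ⁻¹)ξ_n^{an}(1)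
− ρ^{3/2}ξ_n^{an}(1)(ξ_n^{an})′(ρ)`."

## What is here (all PROVED; one definition with body, no named fact)

Tree normalisation (as in `SeriesRemainderBounds.lean`): `ψ = ψ_n = prolateFun n = ξ_n/√2`
(`∫_{-1}^1 ψ² = 1`, cut off outside `[−1,1]`), `η̃ = cosTransform ψ = η_n/√2`, `λ(n) = prolateEigen n`.

* `hasDerivAt_flux_right`, `flux_eq_integral_right`, `eq_zero_of_prolateODE_right` — **uniqueness at
  the regular-singular endpoint `y = 1⁺`** of the prolate equation `(1−y²)v″ = 2yv′ + ((2πy)²−χ)v`: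
  a solution on `(1,b)` that is continuous on `[1,b]`, has bounded derivative near `1⁺` and vanishes
  at `1` vanishes on `[1,b]` (the flux `(y²−1)v′` has derivative `(χ−(2πy)²)v`, hence equals
  `∫_1^y(χ−(2πt)²)v`; so `|v′| ≤ (K/2)·max_{[1,y]}|v|`, and an induction in steps of length `1/K`
  with the mean value inequality).  The indicial roots at `1` being `0, 0`, the second Frobenius
  solution has a logarithm: boundedness of `v′` excludes it.
* `IsProlateFunction.cosTransform_eq_mul_of_ode`, `cosTransform_prolateFun_eq_mul_of_ode`,
  `cosTransform_prolateFun_eq_mul_of_contDiffOn` — **the continuation identity**: if `u` solves the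
  prolate equation (eigenvalue `χ` of `ψ_n`) on `(1,b)`, is `C¹`-regular at `1⁺` and `u(1) = ψ_n(1)`,
  then `η̃(y) = λ(n)·u(y)` on `[1,b]` — `η̃` solves the same equation for every real `y` (the tree's
  `IsProlateFunction.integral_mul_cos_ode`, Slepian's commuting miracle) and `η̃(1) = λ(n)ψ_n(1)`
  ((74)/(cosalphan) at `ω = 1`, the tree's `IsProlateFunction.integral_mul_cos_eq_mul`).  This is the
  form a certificate consumes (e.g. the Frobenius series of `ψ_n` at `x = 1`, radius `2`).
* `prolateFunAn n := η̃_n/λ(n)` — CC's `ξ_n^{an}/√2`: `cosTransform_prolateFun_eq_mul_prolateFunAn`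
  (`η̃_n = λ(n)ψ_n^{an}` on ALL of `ℝ`, the printed "`η_n = λ(n)ξ_n^{an}`"), `prolateFunAn_eq_prolateFun`
  (`= ψ_n` on `[−1,1]`, via the tree's (74) `cosTransform_prolateFun_eq`), `contDiff_prolateFunAn`, `prolateFunAn_ode` (the prolate equation on `ℝ`),
  `derivWithin_prolateFun_eq` (`D⁺ψ_n = (ψ_n^{an})′` on `[−1,1]`, one-sided at `±1`),
  `prolateFunAn_eq_of_ode` (any regular ODE-continuation of `ψ_n` past `1` IS `ψ_n^{an}`).
* `sonineCTerm n ρ` = the printed `C_n(ρ)` of (99) in tree normalisation and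
  **`sonineQTerm_prolateFun_eq`**: `τ(n)T_n(ρ) = λ(n)²(1−λ(n)²)⁻¹·C_n(ρ)` for `ρ ≥ 1` — eq. (99).
* `cosTransform_prolateFun_eq_mul_frobSol`, `prolateFunAn_eq_frobNormConst_mul_frobSol` — the
  certificate hook: at a critical Frobenius parameter `b` with `k` zeros (the tree's
  `prolateFun_eq_frobEvenExt`: `ψ_k = C_b·u_b(|·|)` on `[−1,1]`), `η̃_k = λ(k)·C_b·u_b` on `[1,3)` and
  `ψ_k^{an} = C_b·u_b` on the whole disc `(−1,3)` of the Frobenius series `u_b = frobSol 1 b`.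

WHAT THIS IS NOT: no numerical value of any `C_n`, no statement about the decay of `λ(n)`, nothing
about `ζ` or RH.
-/

noncomputable section

open Real MeasureTheory Set Filter intervalIntegral
open scoped Topology

namespace Literature.NumberTheory.ConnesConsani2021

open Literature.NumberTheory.LFunctions

/-! ## Uniqueness at the regular-singular endpoint `y = 1⁺` of the prolate equation -/

section Singular

variable {χ b : ℝ} {v v₁ v₂ : ℝ → ℝ}

/-- The flux `(y²−1)v′` of a solution of `(1−y²)v″ = 2yv′ + ((2πy)²−χ)v` on `(1,b)` has derivative
`(χ − (2πy)²)v` (divergence form of the prolate operator). [folklore]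
[cite: ConnesConsani2021, §4 p. 16 eq. (prolateeq) (the operator `𝐖`); §5 p. 32 (text before eq. (99))] -/
theorem hasDerivAt_flux_right
    (hv₁ : ∀ y ∈ Ioo 1 b, HasDerivAt v₁ (v₂ y) y)
    (hode : ∀ y ∈ Ioo 1 b, (1 - y ^ 2) * v₂ y = 2 * y * v₁ y + ((2 * π * y) ^ 2 - χ) * v y)
    {y : ℝ} (hy : y ∈ Ioo 1 b) :
    HasDerivAt (fun t ↦ (t ^ 2 - 1) * v₁ t) ((χ - (2 * π * y) ^ 2) * v y) y := by
  have h1 : HasDerivAt (fun t : ℝ ↦ t ^ 2 - 1) (2 * y) y := by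
    simpa using (hasDerivAt_pow 2 y).sub_const 1
  exact (h1.mul (hv₁ y hy)).congr_deriv (by linear_combination -(hode y hy))

/-- **Flux identity at the singular endpoint.**  If moreover `v` is continuous on `[1,b]` and `v′` is
bounded on `(1,b)`, then `(y²−1)v′(y) = ∫_1^y (χ − (2πt)²)v(t)dt` for `y ∈ (1,b)` (the flux extends by
`0` to `y = 1`). [folklore] [cite: CoddingtonLevinson1955, Ch. 4 §1 (regular singular points)] -/
theorem flux_eq_integral_right (hb : 1 < b) (hvc : ContinuousOn v (Icc 1 b))
    (hv₁ : ∀ y ∈ Ioo 1 b, HasDerivAt v₁ (v₂ y) y)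
    (hode : ∀ y ∈ Ioo 1 b, (1 - y ^ 2) * v₂ y = 2 * y * v₁ y + ((2 * π * y) ^ 2 - χ) * v y)
    (hB : ∃ B, ∀ y ∈ Ioo 1 b, |v₁ y| ≤ B) {y : ℝ} (hy : y ∈ Ioo 1 b) :
    (y ^ 2 - 1) * v₁ y = ∫ t in (1 : ℝ)..y, (χ - (2 * π * t) ^ 2) * v t := by
  obtain ⟨B, hB⟩ := hB
  have _ := hb
  set w : ℝ → ℝ := fun t ↦ (χ - (2 * π * t) ^ 2) * v t with hw
  -- `w` is continuous on `[1,b]`, hence bounded and interval integrable there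
  have hwc : ContinuousOn w (Icc 1 b) := ContinuousOn.mul (by fun_prop) hvc
  obtain ⟨W, hW⟩ := isCompact_Icc.exists_bound_of_continuousOn hwc
  have hW0 : 0 ≤ W := (norm_nonneg _).trans (hW 1 ⟨le_rfl, hb.le⟩)
  have hwi : ∀ s t, s ∈ Icc 1 b → t ∈ Icc 1 b → IntervalIntegrable w volume s t := by
    intro s t hs ht
    refine (hwc.mono ?_).intervalIntegrable
    exact uIcc_subset_Icc hs ht
  -- FTC on `[s, y] ⊂ (1, b)`
  have hFTC : ∀ s ∈ Ioo 1 y, (y ^ 2 - 1) * v₁ y - (s ^ 2 - 1) * v₁ s = ∫ t in s..y, w t := by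
    intro s hs
    have hsub : uIcc s y ⊆ Ioo 1 b := by
      rw [uIcc_of_le hs.2.le]
      exact fun t ht ↦ ⟨lt_of_lt_of_le hs.1 ht.1, lt_of_le_of_lt ht.2 hy.2⟩
    rw [intervalIntegral.integral_eq_sub_of_hasDerivAt
      (f := fun t ↦ (t ^ 2 - 1) * v₁ t) (f' := w)
      (fun t ht ↦ hasDerivAt_flux_right hv₁ hode (hsub ht))
      (hwi s y ⟨hs.1.le, (hs.2.trans hy.2).le⟩ ⟨hy.1.le, hy.2.le⟩)]
  -- the constant `c = flux(y) − ∫_1^y w` is `flux(s) − ∫_1^s w` for every `s ∈ (1, y)`, and that is small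
  set c : ℝ := (y ^ 2 - 1) * v₁ y - ∫ t in (1 : ℝ)..y, w t with hc
  have hcs : ∀ s ∈ Ioo 1 y, |c| ≤ ((b + 1) * |B| + W) * (s - 1) := by
    intro s hs
    have hsb : s ∈ Icc 1 b := ⟨hs.1.le, (hs.2.trans hy.2).le⟩
    have hadd : ∫ t in (1 : ℝ)..y, w t = (∫ t in (1 : ℝ)..s, w t) + ∫ t in s..y, w t :=
      (intervalIntegral.integral_add_adjacent_intervals (hwi 1 s ⟨le_rfl, hb.le⟩ hsb)
        (hwi s y hsb ⟨hy.1.le, hy.2.le⟩)).symm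
    have e : c = (s ^ 2 - 1) * v₁ s - ∫ t in (1 : ℝ)..s, w t := by
      rw [hc, hadd]; linarith [hFTC s hs]
    have h1 : |(s ^ 2 - 1) * v₁ s| ≤ (b + 1) * |B| * (s - 1) := by
      rw [abs_mul, abs_of_pos (by nlinarith [hs.1] : (0 : ℝ) < s ^ 2 - 1)]
      have hv₁s : |v₁ s| ≤ |B| := (hB s ⟨hs.1, hs.2.trans hy.2⟩).trans (le_abs_self B)
      have hs1 : s ^ 2 - 1 ≤ (b + 1) * (s - 1) := by nlinarith [hs.1, hsb.2]
      calc (s ^ 2 - 1) * |v₁ s| ≤ (b + 1) * (s - 1) * |B| :=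
            mul_le_mul hs1 hv₁s (abs_nonneg _) (by nlinarith [hs.1, hsb.2])
        _ = (b + 1) * |B| * (s - 1) := by ring
    have h2 : |∫ t in (1 : ℝ)..s, w t| ≤ W * (s - 1) := by
      rw [← Real.norm_eq_abs]
      have h := intervalIntegral.norm_integral_le_of_norm_le_const (a := (1 : ℝ)) (b := s)
        (f := w) (C := W) fun t ht ↦ by
          rw [uIoc_of_le hs.1.le] at ht
          exact hW t ⟨ht.1.le, ht.2.trans hsb.2⟩
      rwa [abs_of_pos (by linarith [hs.1] : (0 : ℝ) < s - 1)] at h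
    rw [e]
    calc |(s ^ 2 - 1) * v₁ s - ∫ t in (1 : ℝ)..s, w t|
        ≤ |(s ^ 2 - 1) * v₁ s| + |∫ t in (1 : ℝ)..s, w t| := abs_sub _ _
      _ ≤ (b + 1) * |B| * (s - 1) + W * (s - 1) := add_le_add h1 h2
      _ = ((b + 1) * |B| + W) * (s - 1) := by ring
  -- hence `c = 0`
  have hc0 : c = 0 := by
    by_contra hne
    have hcpos : 0 < |c| := abs_pos.2 hne
    set C : ℝ := (b + 1) * |B| + W with hC
    have hC0 : 0 ≤ C := by rw [hC]; positivity
    set s : ℝ := min ((1 + y) / 2) (1 + |c| / (2 * (C + 1))) with hs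
    have hpos : 0 < |c| / (2 * (C + 1)) := by positivity
    have hs1 : 1 < s := by
      rw [hs, lt_min_iff]
      exact ⟨by linarith [hy.1], by linarith⟩
    have hsy : s < y := lt_of_le_of_lt (min_le_left _ _) (by linarith [hy.1])
    have h := hcs s ⟨hs1, hsy⟩
    have hs2 : s - 1 ≤ |c| / (2 * (C + 1)) := by linarith [min_le_right ((1 + y) / 2) (1 + |c| / (2 * (C + 1)))]
    have h3 : C * (s - 1) ≤ C * (|c| / (2 * (C + 1))) := mul_le_mul_of_nonneg_left hs2 hC0
    have h4 : C * (|c| / (2 * (C + 1))) < |c| := by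
      rw [show C * (|c| / (2 * (C + 1))) = |c| * (C / (2 * (C + 1))) by ring]
      have : C / (2 * (C + 1)) < 1 := by
        rw [div_lt_one (by positivity)]; linarith
      nlinarith
    linarith
  have := hc0
  rw [hc] at this
  linarith

/-- **Uniqueness at the regular-singular endpoint `1⁺`** of the prolate equation
`(1−y²)v″ = 2yv′ + ((2πy)²−χ)v`: a solution on `(1,b)` which is continuous on `[1,b]`, has bounded
derivative on `(1,b)` and vanishes at `1` vanishes on `[1,b]`.  (The indicial roots at `y = 1` are
`0, 0`; the second Frobenius solution carries `log(y−1)` and has unbounded derivative, so the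
hypotheses pin the analytic branch, which is determined by its value at `1`.)  Proof: by the flux
identity `|v′(y)| ≤ (K/2)·max_{[1,y]}|v|` with `K = |χ| + (2πb)² + 1`; the mean value inequality then
gives `max_{[1,y]}|v| ≤ ½ max_{[1,y]}|v|` on every step of length `1/K` beyond an interval where `v`
already vanishes. [cite: CoddingtonLevinson1955, Ch. 4 §1, §8 (regular singular points, indicial equation)] -/
theorem eq_zero_of_prolateODE_right (hb : 1 < b) (hvc : ContinuousOn v (Icc 1 b))
    (hv : ∀ y ∈ Ioo 1 b, HasDerivAt v (v₁ y) y) (hv₁ : ∀ y ∈ Ioo 1 b, HasDerivAt v₁ (v₂ y) y)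
    (hode : ∀ y ∈ Ioo 1 b, (1 - y ^ 2) * v₂ y = 2 * y * v₁ y + ((2 * π * y) ^ 2 - χ) * v y)
    (hB : ∃ B, ∀ y ∈ Ioo 1 b, |v₁ y| ≤ B) (h1 : v 1 = 0) :
    ∀ y ∈ Icc 1 b, v y = 0 := by
  -- `|χ − (2πt)²| ≤ K` on `[1,b]`
  set K : ℝ := |χ| + (2 * π * b) ^ 2 + 1 with hK
  have hK0 : 0 < K := by rw [hK]; positivity
  have hKb : ∀ t ∈ Icc 1 b, |χ - (2 * π * t) ^ 2| ≤ K := by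
    intro t ht
    have ht0 : 0 ≤ 2 * π * t := by have := Real.pi_pos; nlinarith [ht.1]
    have h2 : (2 * π * t) ^ 2 ≤ (2 * π * b) ^ 2 :=
      pow_le_pow_left₀ ht0 (by nlinarith [ht.2, Real.pi_pos]) 2
    calc |χ - (2 * π * t) ^ 2| ≤ |χ| + |(2 * π * t) ^ 2| := abs_sub _ _
      _ = |χ| + (2 * π * t) ^ 2 := by rw [abs_of_nonneg (by positivity : (0 : ℝ) ≤ (2 * π * t) ^ 2)]
      _ ≤ K := by rw [hK]; linarith
  have hflux := fun y (hy : y ∈ Ioo 1 b) ↦ flux_eq_integral_right hb hvc hv₁ hode hB hy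
  -- Step 1: `|v′(y)| ≤ (K/2)·M` whenever `|v| ≤ M` on `[1, y]`
  have hder : ∀ y ∈ Ioo 1 b, ∀ M : ℝ, (∀ t ∈ Icc 1 y, |v t| ≤ M) → |v₁ y| ≤ K / 2 * M := by
    intro y hy M hM
    have hy1 : 0 < y - 1 := by linarith [hy.1]
    have hy2 : 0 < y ^ 2 - 1 := by nlinarith [hy.1]
    have hint : |∫ t in (1 : ℝ)..y, (χ - (2 * π * t) ^ 2) * v t| ≤ K * M * |y - 1| := by
      rw [← Real.norm_eq_abs]
      refine intervalIntegral.norm_integral_le_of_norm_le_const fun t ht ↦ ?_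
      rw [uIoc_of_le hy.1.le] at ht
      rw [Real.norm_eq_abs, abs_mul]
      exact mul_le_mul (hKb t ⟨ht.1.le, ht.2.trans hy.2.le⟩) (hM t ⟨ht.1.le, ht.2⟩)
        (abs_nonneg _) hK0.le
    rw [abs_of_pos hy1, ← hflux y hy, abs_mul, abs_of_pos hy2] at hint
    have h3 : |v₁ y| * (2 * (y - 1)) ≤ (y ^ 2 - 1) * |v₁ y| := by
      rw [mul_comm]
      exact mul_le_mul_of_nonneg_right (by nlinarith [hy.1]) (abs_nonneg _)
    have h5 : |v₁ y| * 2 * (y - 1) ≤ K / 2 * M * 2 * (y - 1) := by nlinarith [h3, hint]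
    have h6 := le_of_mul_le_mul_right h5 hy1
    linarith
  -- Step 2: `|v(y) − v(a)| ≤ (K/2)·M·(y − a)` for `1 ≤ a ≤ y`, `|v| ≤ M` on `[1,y]` (MVT; `a = 1` by closure)
  have hkey : ∀ y ∈ Ioo 1 b, ∀ M : ℝ, (∀ t ∈ Icc 1 y, |v t| ≤ M) →
      ∀ a ∈ Icc 1 y, |v y - v a| ≤ K / 2 * M * (y - a) := by
    intro y hy M hM
    have hM0 : 0 ≤ M := (abs_nonneg _).trans (hM 1 ⟨le_rfl, hy.1.le⟩)
    -- for `a > 1`: the mean value inequality on `[a, y]`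
    have hIoc : ∀ a ∈ Ioc 1 y, |v y - v a| ≤ K / 2 * M * (y - a) := by
      intro a ha
      have hsub : Icc a y ⊆ Ioo 1 b := fun t ht ↦ ⟨lt_of_lt_of_le ha.1 ht.1, lt_of_le_of_lt ht.2 hy.2⟩
      have h := norm_image_sub_le_of_norm_deriv_le_segment' (f := v) (f' := v₁) (a := a) (b := y)
        (C := K / 2 * M) (fun t ht ↦ (hv t (hsub ht)).hasDerivWithinAt) (fun t ht ↦ by
          rw [Real.norm_eq_abs]
          exact hder t (hsub ⟨ht.1, ht.2.le⟩) M fun s hs ↦ hM s ⟨hs.1, hs.2.trans ht.2.le⟩)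
        y ⟨ha.2, le_rfl⟩
      rwa [Real.norm_eq_abs] at h
    -- `a = 1` by continuity
    have hcl : closure (Ioc 1 y) = Icc 1 y := closure_Ioc (ne_of_lt hy.1)
    have hvy : ContinuousOn v (Icc 1 y) := hvc.mono (Icc_subset_Icc le_rfl hy.2.le)
    intro a ha
    have h := le_on_closure (f := fun a ↦ |v y - v a|) (g := fun a ↦ K / 2 * M * (y - a))
      (s := Ioc 1 y) hIoc ?_ ?_ (x := a) (by rw [hcl]; exact ha)
    · exact h
    · rw [hcl]
      exact (continuous_abs.comp_continuousOn (continuousOn_const.sub hvy))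
    · rw [hcl]; fun_prop
  -- Step 3: induction in steps of length `1/K`
  have main : ∀ k : ℕ, ∀ y ∈ Ico 1 b, y ≤ 1 + k / K → v y = 0 := by
    intro k
    induction k with
    | zero =>
      intro y hy hyk
      simp only [Nat.cast_zero, zero_div, add_zero] at hyk
      rw [le_antisymm hyk hy.1, h1]
    | succ k ih =>
      intro y hy hyk
      by_cases hya : y ≤ 1 + k / K
      · exact ih y hy hya
      push Not at hya
      set a : ℝ := 1 + k / K with ha
      have ha1 : 1 ≤ a := by
        rw [ha]; have : (0 : ℝ) ≤ k / K := by positivity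
        linarith
      have hy1 : 1 < y := lt_of_le_of_lt ha1 hya
      have hstep' : y ≤ a + 1 / K := by
        rw [ha]; push_cast at hyk
        have e : (1 : ℝ) + ((k : ℝ) + 1) / K = 1 + k / K + 1 / K := by ring
        linarith [e]
      -- `v = 0` on `[1, a]`
      have hva : ∀ t ∈ Icc 1 a, v t = 0 := fun t ht ↦
        ih t ⟨ht.1, lt_of_le_of_lt ht.2 (hya.trans hy.2)⟩ ht.2
      -- a maximiser of `|v|` on `[1, y]`
      obtain ⟨tm, htm, hmax⟩ := isCompact_Icc.exists_isMaxOn (nonempty_Icc.2 hy1.le)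
        (continuous_abs.comp_continuousOn (hvc.mono (Icc_subset_Icc le_rfl hy.2.le)) :
          ContinuousOn (fun t ↦ |v t|) (Icc 1 y))
      have hMb : ∀ t ∈ Icc 1 y, |v t| ≤ |v tm| := fun t ht ↦ (isMaxOn_iff.1 hmax) t ht
      suffices hM0 : |v tm| ≤ 0 by
        have := (hMb y ⟨hy1.le, le_rfl⟩).trans hM0
        exact abs_eq_zero.1 (le_antisymm this (abs_nonneg _))
      by_cases htma : tm ≤ a
      · rw [hva tm ⟨htm.1, htma⟩, abs_zero]
      · push Not at htma
        have htm1 : tm ∈ Ioo 1 b := ⟨lt_of_le_of_lt ha1 htma, lt_of_le_of_lt htm.2 hy.2⟩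
        have hk := hkey tm htm1 |v tm| (fun t ht ↦ hMb t ⟨ht.1, ht.2.trans htm.2⟩) a
          ⟨ha1, htma.le⟩
        rw [hva a ⟨ha1, le_rfl⟩, sub_zero] at hk
        have hstep : tm - a ≤ 1 / K := by linarith [htm.2]
        have h2 : K / 2 * |v tm| * (tm - a) ≤ K / 2 * |v tm| * (1 / K) :=
          mul_le_mul_of_nonneg_left hstep (by positivity)
        have e : K / 2 * |v tm| * (1 / K) = |v tm| / 2 := by field_simp
        linarith [abs_nonneg (v tm)]
  -- Step 4: `[1, b)` by the Archimedean property, `b` by continuity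
  have hIco : ∀ y ∈ Ico 1 b, v y = 0 := by
    intro y hy
    obtain ⟨k, hk⟩ := exists_nat_ge ((y - 1) * K)
    refine main k y hy ?_
    have : y - 1 ≤ k / K := by rw [le_div_iff₀ hK0]; exact hk
    linarith
  intro y hy
  rcases eq_or_lt_of_le hy.2 with rfl | hlt
  · have hcl : closure (Ico 1 y) = Icc 1 y := closure_Ico (ne_of_lt hb)
    have h := le_on_closure (f := fun t ↦ |v t|) (g := fun _ ↦ (0 : ℝ)) (s := Ico 1 y)
      (fun t ht ↦ (abs_eq_zero.2 (hIco t ht)).le) ?_ continuousOn_const (x := y)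
      (by rw [hcl]; exact ⟨hb.le, le_rfl⟩)
    · exact abs_eq_zero.1 (le_antisymm h (abs_nonneg _))
    · rw [hcl]; exact continuous_abs.comp_continuousOn hvc
  · exact hIco y ⟨hy.1, hlt⟩

end Singular

/-! ## The continuation identity: `η̃ = μ·u` past the band edge for any regular ODE-continuation `u` -/

section Continuation

variable {m : ℕ} {ψ : ℝ → ℝ} {χ b : ℝ}

/-- **The finite cosine transform of a prolate function past `1` is `μ` times ANY regular
ODE-continuation.**  Let `ψ = h_{m,1}` be a tree prolate function with eigenvalue `χ`
(`𝐖ψ = χψ` on `(−1,1)`) and `μ = (∫_{-1}^1 ψ)/ψ(0)` its finite-Fourier eigenvalue ((74):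
`η̃ = μψ` on `[−1,1]`, the tree's `IsProlateFunction.integral_mul_cos_eq_mul`).  If `u` solves
`(1−y²)u″ = 2yu′ + ((2πy)²−χ)u` on `(1,b)`, is continuous on `[1,b]` with bounded derivative, and
`u(1) = ψ(1)`, then `η̃(y) = ∫_{-1}^1 ψ(x)cos(2πxy)dx = μ·u(y)` for all `y ∈ [1,b]`.  Indeed `η̃` solves the
same equation for every real `y` (Slepian's commuting miracle, the tree's
`IsProlateFunction.integral_mul_cos_ode`), so `v = η̃ − μu` does on `(1,b)`, with `v(1) = 0`; apply
`eq_zero_of_prolateODE_right`.  This is CC's "`η_n = λ(n)ξ_n^{an}`, thus for `x ∈ [1,∞)` …".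
[cite: ConnesConsani2021, §5 p. 32, text before eq. (99) (arXiv chunk p0020:L69–L72); SlepianPollak1961, §III] -/
theorem _root_.Literature.NumberTheory.LFunctions.IsProlateFunction.cosTransform_eq_mul_of_ode
    (hψ : IsProlateFunction 1 m ψ)
    (hχ : ∀ x ∈ Ioo (-1 : ℝ) 1,
      -(deriv (fun y ↦ (1 ^ 2 - y ^ 2) * deriv ψ y) x) + (2 * π * 1 * x) ^ 2 * ψ x = χ * ψ x)
    (hb : 1 < b) {u u₁ u₂ : ℝ → ℝ} (huc : ContinuousOn u (Icc 1 b))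
    (hu : ∀ y ∈ Ioo 1 b, HasDerivAt u (u₁ y) y) (hu₁ : ∀ y ∈ Ioo 1 b, HasDerivAt u₁ (u₂ y) y)
    (hode : ∀ y ∈ Ioo 1 b, (1 - y ^ 2) * u₂ y = 2 * y * u₁ y + ((2 * π * y) ^ 2 - χ) * u y)
    (hB : ∃ B, ∀ y ∈ Ioo 1 b, |u₁ y| ≤ B) (h1 : u 1 = ψ 1) :
    ∀ y ∈ Icc 1 b, cosTransform ψ y = ((∫ x in (-1 : ℝ)..1, ψ x) / ψ 0) * u y := by
  set μ : ℝ := (∫ x in (-1 : ℝ)..1, ψ x) / ψ 0 with hμ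
  have hψc : ContinuousOn ψ (Icc (-1) 1) := by simpa using hψ.contDiffOn.continuousOn
  have hψi : IntervalIntegrable ψ volume (-1) 1 := by
    apply ContinuousOn.intervalIntegrable; rw [uIcc_of_le (by norm_num)]; exact hψc
  -- `η̃` and its first two derivatives (as differentiated integrals)
  set η : ℝ → ℝ := cosTransform ψ with hη
  set η₁ : ℝ → ℝ := fun y ↦ ∫ x in (-1 : ℝ)..1, ψ x * (-(2 * π * x) * Real.sin (2 * π * x * y))
    with hη₁
  set η₂ : ℝ → ℝ := fun y ↦
    ∫ x in (-1 : ℝ)..1, (ψ x * (-(2 * π * x))) * ((2 * π * x) * Real.cos (2 * π * x * y)) with hη₂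
  have hd1 : ∀ y, HasDerivAt η (η₁ y) y := fun y ↦ hasDerivAt_cosTransform hψc y
  have hd2 : ∀ y, HasDerivAt η₁ (η₂ y) y := by
    intro y
    refine (hasDerivAt_deriv_cosTransform hψi y).congr_deriv ?_
    simp only [hη₂]
    exact intervalIntegral.integral_congr fun x _ ↦ by ring
  -- Slepian: the prolate equation for `η̃` at every real `y`
  have hodeη : ∀ y, (1 - y ^ 2) * η₂ y = 2 * y * η₁ y + ((2 * π * y) ^ 2 - χ) * η y := by
    intro y
    have h := hψ.integral_mul_cos_ode hχ y
    simp only [one_pow, mul_one] at h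
    simpa [hη, hη₁, hη₂, cosTransform] using h
  -- (74) at `ω = 1`
  have hη1 : η 1 = μ * ψ 1 := by
    have h := hψ.integral_mul_cos_eq_mul (ω := 1) ⟨by norm_num, le_rfl⟩
    simpa [hη, cosTransform, hμ] using h
  -- the difference `v = η̃ − μu`
  set v : ℝ → ℝ := fun y ↦ η y - μ * u y with hv
  have hvc : ContinuousOn v (Icc 1 b) :=
    (ContinuousOn.sub (fun y _ ↦ (hd1 y).continuousAt.continuousWithinAt)
      (continuousOn_const.mul huc))
  have hvd : ∀ y ∈ Ioo 1 b, HasDerivAt v (η₁ y - μ * u₁ y) y := fun y hy ↦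
    (hd1 y).sub ((hu y hy).const_mul μ)
  have hvd₁ : ∀ y ∈ Ioo 1 b, HasDerivAt (fun y ↦ η₁ y - μ * u₁ y) (η₂ y - μ * u₂ y) y :=
    fun y hy ↦ (hd2 y).sub ((hu₁ y hy).const_mul μ)
  have hodev : ∀ y ∈ Ioo 1 b, (1 - y ^ 2) * (η₂ y - μ * u₂ y)
      = 2 * y * (η₁ y - μ * u₁ y) + ((2 * π * y) ^ 2 - χ) * v y := by
    intro y hy
    simp only [hv]
    linear_combination hodeη y - μ * hode y hy
  have hBv : ∃ B, ∀ y ∈ Ioo 1 b, |η₁ y - μ * u₁ y| ≤ B := by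
    obtain ⟨B, hB⟩ := hB
    obtain ⟨C, hC⟩ := isCompact_Icc.exists_bound_of_continuousOn (s := Icc 1 b) (f := η₁)
      fun y _ ↦ (hd2 y).continuousAt.continuousWithinAt
    refine ⟨C + |μ| * B, fun y hy ↦ ?_⟩
    have h1 : |η₁ y| ≤ C := by simpa [Real.norm_eq_abs] using hC y (Ioo_subset_Icc_self hy)
    have h2 : |μ * u₁ y| ≤ |μ| * B := by
      rw [abs_mul]; exact mul_le_mul_of_nonneg_left (hB y hy) (abs_nonneg _)
    exact (abs_sub _ _).trans (add_le_add h1 h2)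
  have hv1 : v 1 = 0 := by simp only [hv]; rw [hη1, h1]; ring
  have hzero := eq_zero_of_prolateODE_right hb hvc hvd hvd₁ hodev hBv hv1
  intro y hy
  have h := hzero y hy
  simp only [hv] at h
  linarith

/-- **The continuation identity for THE prolate vectors**: with `λ(n) = prolateEigen n` and
`ψ_n = prolateFun n` (eigenvalue `χ`), every solution `u` of the prolate equation on `(1,b)` that is
continuous on `[1,b]` with bounded derivative and `u(1) = ψ_n(1)` satisfies
`cosTransform ψ_n (y) = λ(n)·u(y)` on `[1,b]` — CC's "`η_n = λ(n)ξ_n^{an}` for `x ∈ [1,∞)`" in the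
form a certificate consumes (`u` = e.g. the Frobenius series of `ψ_n` at `x = 1`, radius `2`, so
`b < 3`). [cite: ConnesConsani2021, §5 p. 32, text before eq. (99) (arXiv chunk p0020:L69–L72)] -/
theorem cosTransform_prolateFun_eq_mul_of_ode {n : ℕ} {χ b : ℝ}
    (hχ : ∀ x ∈ Ioo (-1 : ℝ) 1,
      -(deriv (fun y ↦ (1 ^ 2 - y ^ 2) * deriv (prolateFun n) y) x)
        + (2 * π * 1 * x) ^ 2 * prolateFun n x = χ * prolateFun n x)
    (hb : 1 < b) {u u₁ u₂ : ℝ → ℝ} (huc : ContinuousOn u (Icc 1 b))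
    (hu : ∀ y ∈ Ioo 1 b, HasDerivAt u (u₁ y) y) (hu₁ : ∀ y ∈ Ioo 1 b, HasDerivAt u₁ (u₂ y) y)
    (hode : ∀ y ∈ Ioo 1 b, (1 - y ^ 2) * u₂ y = 2 * y * u₁ y + ((2 * π * y) ^ 2 - χ) * u y)
    (hB : ∃ B, ∀ y ∈ Ioo 1 b, |u₁ y| ≤ B) (h1 : u 1 = prolateFun n 1) :
    ∀ y ∈ Icc 1 b, cosTransform (prolateFun n) y = prolateEigen n * u y := by
  have h := (isProlateFunction_prolateFun n).cosTransform_eq_mul_of_ode hχ hb huc hu hu₁ hode hB h1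
  rw [← prolateEigen_eq_intervalIntegral] at h
  exact h

/-- The same with `u ∈ C²([1,b])` and the equation written with `deriv`: for `u` twice continuously
differentiable on `[1,b]` (one-sided at the ends) solving `(1−y²)u″ = 2yu′ + ((2πy)²−χ)u` on `(1,b)`
with `u(1) = ψ_n(1)`, `cosTransform ψ_n = λ(n)·u` on `[1,b]`.
[cite: ConnesConsani2021, §5 p. 32, text before eq. (99) (arXiv chunk p0020:L69–L72)] -/
theorem cosTransform_prolateFun_eq_mul_of_contDiffOn {n : ℕ} {χ b : ℝ}
    (hχ : ∀ x ∈ Ioo (-1 : ℝ) 1,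
      -(deriv (fun y ↦ (1 ^ 2 - y ^ 2) * deriv (prolateFun n) y) x)
        + (2 * π * 1 * x) ^ 2 * prolateFun n x = χ * prolateFun n x)
    (hb : 1 < b) {u : ℝ → ℝ} (hu : ContDiffOn ℝ 2 u (Icc 1 b))
    (hode : ∀ y ∈ Ioo 1 b,
      (1 - y ^ 2) * deriv (deriv u) y = 2 * y * deriv u y + ((2 * π * y) ^ 2 - χ) * u y)
    (h1 : u 1 = prolateFun n 1) :
    ∀ y ∈ Icc 1 b, cosTransform (prolateFun n) y = prolateEigen n * u y := by
  have hU : UniqueDiffOn ℝ (Icc 1 b) := uniqueDiffOn_Icc hb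
  have h2 := hu
  rw [show (2 : WithTop ℕ∞) = 1 + 1 from rfl, contDiffOn_succ_iff_derivWithin hU] at h2
  obtain ⟨hd1, -, hc1⟩ := h2
  rw [show (1 : WithTop ℕ∞) = 0 + 1 from rfl, contDiffOn_succ_iff_derivWithin hU] at hc1
  obtain ⟨hd2, -, -⟩ := hc1
  have hnhds : ∀ y ∈ Ioo 1 b, Icc 1 b ∈ 𝓝 y := fun y hy ↦ Icc_mem_nhds hy.1 hy.2
  -- interior derivatives
  have hIoo1 : ∀ y ∈ Ioo 1 b, derivWithin u (Icc 1 b) y = deriv u y := fun y hy ↦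
    derivWithin_of_mem_nhds (hnhds y hy)
  have hu' : ∀ y ∈ Ioo 1 b, HasDerivAt u (derivWithin u (Icc 1 b) y) y := fun y hy ↦
    ((hd1 y (Ioo_subset_Icc_self hy)).hasDerivWithinAt.hasDerivAt (hnhds y hy))
  have hu'' : ∀ y ∈ Ioo 1 b, HasDerivAt (derivWithin u (Icc 1 b))
      (derivWithin (derivWithin u (Icc 1 b)) (Icc 1 b) y) y := fun y hy ↦
    ((hd2 y (Ioo_subset_Icc_self hy)).hasDerivWithinAt.hasDerivAt (hnhds y hy))
  have hIoo2 : ∀ y ∈ Ioo 1 b,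
      derivWithin (derivWithin u (Icc 1 b)) (Icc 1 b) y = deriv (deriv u) y := by
    intro y hy
    rw [derivWithin_of_mem_nhds (hnhds y hy)]
    refine Filter.EventuallyEq.deriv_eq ?_
    filter_upwards [isOpen_Ioo.mem_nhds hy] with z hz using hIoo1 z hz
  have hode' : ∀ y ∈ Ioo 1 b, (1 - y ^ 2) * derivWithin (derivWithin u (Icc 1 b)) (Icc 1 b) y
      = 2 * y * derivWithin u (Icc 1 b) y + ((2 * π * y) ^ 2 - χ) * u y := by
    intro y hy; rw [hIoo2 y hy, hIoo1 y hy]; exact hode y hy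
  -- the derivative is continuous on `[1,b]`, hence bounded
  have hB : ∃ B, ∀ y ∈ Ioo 1 b, |derivWithin u (Icc 1 b) y| ≤ B := by
    obtain ⟨B, hB⟩ := isCompact_Icc.exists_bound_of_continuousOn
      (hd2.continuousOn : ContinuousOn (derivWithin u (Icc 1 b)) (Icc 1 b))
    exact ⟨B, fun y hy ↦ by simpa [Real.norm_eq_abs] using hB y (Ioo_subset_Icc_self hy)⟩
  exact cosTransform_prolateFun_eq_mul_of_ode hχ hb hu.continuousOn hu' hu'' hode' hB h1

end Continuation

/-! ## CC's `ξ_n^{an}`: the analytic continuation of the prolate vectors -/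

section Analytic

/-- **CC's `ξ_n^{an}` in tree normalisation: `ψ_n^{an} := η̃_n / λ(n) = cosTransform ψ_n / λ(n)`**
(`λ(n) ≠ 0`, the tree's `prolateEigen_ne_zero`).  It is real-analytic on `ℝ` (a finite Fourier
integral), coincides with `ψ_n = prolateFun n` on `[−1,1]` by (74)/(cosalphan), and solves the prolate
equation on all of `ℝ`; hence it IS "the analytic continuation of `ξ_n`" (up to the factor `√2` of the
tree normalisation `ξ_n = √2ψ_n`), and `η̃_n = λ(n)ψ_n^{an}` everywhere — the printed
"`η_n = λ(n)ξ_n^{an}`". [cite: ConnesConsani2021, §5 p. 32, text before eq. (99) (arXiv chunk p0020:L69–L72)] -/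
def prolateFunAn (n : ℕ) (y : ℝ) : ℝ :=
  cosTransform (prolateFun n) y / prolateEigen n

/-- `ψ_n^{an} = λ(n)⁻¹ · η̃_n` as functions. [cite: ConnesConsani2021, §5 p. 32, text before eq. (99)] -/
theorem prolateFunAn_eq (n : ℕ) :
    prolateFunAn n = fun y ↦ (prolateEigen n)⁻¹ * cosTransform (prolateFun n) y := by
  funext y; rw [prolateFunAn, div_eq_inv_mul]

/-- **`η̃_n = λ(n)·ψ_n^{an}` on all of `ℝ`** (the printed "`η_n = λ(n)ξ_n^{an}`").
[cite: ConnesConsani2021, §5 p. 32, text before eq. (99) (arXiv chunk p0020:L69–L72)] -/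
theorem cosTransform_prolateFun_eq_mul_prolateFunAn (n : ℕ) (y : ℝ) :
    cosTransform (prolateFun n) y = prolateEigen n * prolateFunAn n y := by
  rw [prolateFunAn, mul_div_cancel₀ _ (prolateEigen_ne_zero n)]

/-- **`ψ_n^{an} = ψ_n` on `[−1,1]`.** [cite: ConnesConsani2021, §5 p. 32, text before eq. (99); §4 p. 16 eq. (cosalphan)] -/
theorem prolateFunAn_eq_prolateFun {n : ℕ} {y : ℝ} (hy : y ∈ Icc (-1 : ℝ) 1) :
    prolateFunAn n y = prolateFun n y := by
  rw [prolateFunAn, cosTransform_prolateFun_eq hy n, mul_div_cancel_left₀ _ (prolateEigen_ne_zero n)]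

/-- `ψ_n^{an}(1) = ψ_n(1)` (CC: "and moreover `ξ_n^{an}(1) = ξ_n(1)`", proof of Lemma 5.4).
[cite: ConnesConsani2021, Lemma 5.4 proof §5 p. 33 (arXiv item Lemma 31, chunk p0020:L97)] -/
theorem prolateFunAn_one (n : ℕ) : prolateFunAn n 1 = prolateFun n 1 :=
  prolateFunAn_eq_prolateFun ⟨by norm_num, le_rfl⟩

/-- `ψ_n^{an}` is `C²` on `ℝ` (indeed real-analytic; `C²` is what the (99) bookkeeping uses).
[cite: ConnesConsani2021, §5 p. 32, text before eq. (99)] -/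
theorem contDiff_prolateFunAn (n : ℕ) : ContDiff ℝ 2 (prolateFunAn n) := by
  rw [prolateFunAn_eq]
  exact contDiff_const.mul (contDiff_two_cosTransform_of_isProlateFunction
    (isProlateFunction_prolateFun n))

/-- `ψ_n^{an}` is even. [cite: ConnesConsani2021, §4 p. 16 (the even prolate functions `φ_n = PS_{2n,0}`)] -/
theorem prolateFunAn_neg (n : ℕ) (y : ℝ) : prolateFunAn n (-y) = prolateFunAn n y := by
  simp only [prolateFunAn, cosTransform]
  congr 1
  exact intervalIntegral.integral_congr fun x _ ↦ by
    rw [show 2 * π * x * -y = -(2 * π * x * y) by ring, Real.cos_neg]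

/-- The first derivative of `ψ_n^{an}`: `λ(n)·(ψ_n^{an})′ = η̃_n′`.
[cite: ConnesConsani2021, §5 p. 32, text before eq. (99)] -/
theorem deriv_prolateFunAn (n : ℕ) (y : ℝ) :
    deriv (prolateFunAn n) y = (prolateEigen n)⁻¹ * deriv (cosTransform (prolateFun n)) y := by
  rw [prolateFunAn_eq, deriv_const_mul_field]

/-- The second derivative of `ψ_n^{an}`. [cite: ConnesConsani2021, §5 p. 32, text before eq. (99)] -/
theorem deriv_deriv_prolateFunAn (n : ℕ) (y : ℝ) :
    deriv (deriv (prolateFunAn n)) y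
      = (prolateEigen n)⁻¹ * deriv (deriv (cosTransform (prolateFun n))) y := by
  have h : deriv (prolateFunAn n)
      = fun y ↦ (prolateEigen n)⁻¹ * deriv (cosTransform (prolateFun n)) y :=
    funext (deriv_prolateFunAn n)
  rw [h, deriv_const_mul_field]

/-- **`ψ_n^{an}` solves the prolate equation on all of `ℝ`**: with the eigenvalue `χ` of `ψ_n`,
`(1−y²)(ψ_n^{an})″ = 2y(ψ_n^{an})′ + ((2πy)²−χ)ψ_n^{an}` for every real `y` (Slepian's commuting
miracle, the tree's `IsProlateFunction.integral_mul_cos_ode`, divided by `λ(n)`).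
[cite: ConnesConsani2021, §4 p. 16 eq. (prolateeq); §5 p. 32, text before eq. (99); SlepianPollak1961, §III] -/
theorem prolateFunAn_ode {n : ℕ} {χ : ℝ}
    (hχ : ∀ x ∈ Ioo (-1 : ℝ) 1,
      -(deriv (fun y ↦ (1 ^ 2 - y ^ 2) * deriv (prolateFun n) y) x)
        + (2 * π * 1 * x) ^ 2 * prolateFun n x = χ * prolateFun n x) (y : ℝ) :
    (1 - y ^ 2) * deriv (deriv (prolateFunAn n)) y
      = 2 * y * deriv (prolateFunAn n) y + ((2 * π * y) ^ 2 - χ) * prolateFunAn n y := by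
  have hψ := isProlateFunction_prolateFun n
  have hψc : ContinuousOn (prolateFun n) (Icc (-1) 1) := by
    simpa using hψ.contDiffOn.continuousOn
  have hψi : IntervalIntegrable (prolateFun n) volume (-1) 1 := by
    apply ContinuousOn.intervalIntegrable; rw [uIcc_of_le (by norm_num)]; exact hψc
  have h := hψ.integral_mul_cos_ode hχ y
  simp only [one_pow, mul_one] at h
  have e1 : deriv (cosTransform (prolateFun n)) y
      = ∫ x in (-1 : ℝ)..1, prolateFun n x * (-(2 * π * x) * Real.sin (2 * π * x * y)) := by
    rw [deriv_cosTransform hψi]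
  have e2 : deriv (deriv (cosTransform (prolateFun n))) y
      = ∫ x in (-1 : ℝ)..1,
          (prolateFun n x * (-(2 * π * x))) * ((2 * π * x) * Real.cos (2 * π * x * y)) := by
    rw [deriv_deriv_cosTransform hψi]
    exact intervalIntegral.integral_congr fun x _ ↦ by ring
  have e0 : prolateFunAn n y = (prolateEigen n)⁻¹ * cosTransform (prolateFun n) y := by
    rw [prolateFunAn_eq]
  rw [deriv_deriv_prolateFunAn, deriv_prolateFunAn, e0, e1, e2, cosTransform]
  linear_combination (prolateEigen n)⁻¹ * h

/-- **`D⁺ψ_n = (ψ_n^{an})′` on `[−1,1]`**: the one-sided derivative of the cut-off prolate function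
within `[−1,1]` (the `D_u` of Lemma 5.2 / App. F, `scaleDerivIn`) is the derivative of its analytic
continuation, also at the end points.
[cite: ConnesConsani2021, §5 Lemma 5.2 (arXiv item 29, chunk p0019:L77); §5 p. 32, text before eq. (99)] -/
theorem derivWithin_prolateFun_eq {n : ℕ} {y : ℝ} (hy : y ∈ Icc (-1 : ℝ) 1) :
    derivWithin (prolateFun n) (Icc (-1) 1) y = deriv (prolateFunAn n) y := by
  have hU : UniqueDiffWithinAt ℝ (Icc (-1 : ℝ) 1) y := uniqueDiffOn_Icc (by norm_num) y hy
  have hd : DifferentiableAt ℝ (prolateFunAn n) y :=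
    ((contDiff_prolateFunAn n).differentiable (by norm_num)).differentiableAt
  rw [derivWithin_congr (fun x hx ↦ (prolateFunAn_eq_prolateFun hx).symm)
    (prolateFunAn_eq_prolateFun hy).symm, hd.hasDerivAt.hasDerivWithinAt.derivWithin hU]

/-- `D_uψ_n(x) = x(ψ_n^{an})′(x)` on `[−1,1]`. [cite: ConnesConsani2021, App. F (chunk p0035:L12); §5 eq. (99)] -/
theorem scaleDerivIn_prolateFun_eq {n : ℕ} {x : ℝ} (hx : x ∈ Icc (-1 : ℝ) 1) :
    scaleDerivIn (prolateFun n) x = x * deriv (prolateFunAn n) x := by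
  rw [scaleDerivIn, derivWithin_prolateFun_eq hx]

/-- `D_uη̃_n(y) = λ(n)·y(ψ_n^{an})′(y)` for every real `y`. [cite: ConnesConsani2021, App. F (chunk p0035:L12); §5 eq. (99)] -/
theorem scaleDeriv_cosTransform_prolateFun_eq (n : ℕ) (y : ℝ) :
    scaleDeriv (cosTransform (prolateFun n)) y = prolateEigen n * (y * deriv (prolateFunAn n) y) := by
  rw [scaleDeriv, deriv_prolateFunAn, mul_left_comm (prolateEigen n) y,
    mul_inv_cancel_left₀ (prolateEigen_ne_zero n)]

/-- **Any regular ODE-continuation of `ψ_n` past `1` IS `ψ_n^{an}`**: if `u` is continuous on `[1,b]`,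
solves the prolate equation (eigenvalue `χ` of `ψ_n`) on `(1,b)` with bounded derivative and
`u(1) = ψ_n(1)`, then `u = ψ_n^{an}` on `[1,b]` (from `cosTransform_prolateFun_eq_mul_of_ode` and
`λ(n) ≠ 0`). [cite: ConnesConsani2021, §5 p. 32, text before eq. (99) (arXiv chunk p0020:L69–L72)] -/
theorem prolateFunAn_eq_of_ode {n : ℕ} {χ b : ℝ}
    (hχ : ∀ x ∈ Ioo (-1 : ℝ) 1,
      -(deriv (fun y ↦ (1 ^ 2 - y ^ 2) * deriv (prolateFun n) y) x)
        + (2 * π * 1 * x) ^ 2 * prolateFun n x = χ * prolateFun n x)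
    (hb : 1 < b) {u u₁ u₂ : ℝ → ℝ} (huc : ContinuousOn u (Icc 1 b))
    (hu : ∀ y ∈ Ioo 1 b, HasDerivAt u (u₁ y) y) (hu₁ : ∀ y ∈ Ioo 1 b, HasDerivAt u₁ (u₂ y) y)
    (hode : ∀ y ∈ Ioo 1 b, (1 - y ^ 2) * u₂ y = 2 * y * u₁ y + ((2 * π * y) ^ 2 - χ) * u y)
    (hB : ∃ B, ∀ y ∈ Ioo 1 b, |u₁ y| ≤ B) (h1 : u 1 = prolateFun n 1) :
    ∀ y ∈ Icc 1 b, u y = prolateFunAn n y := by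
  intro y hy
  have h := cosTransform_prolateFun_eq_mul_of_ode hχ hb huc hu hu₁ hode hB h1 y hy
  rw [cosTransform_prolateFun_eq_mul_prolateFunAn] at h
  exact (mul_left_cancel₀ (prolateEigen_ne_zero n) h).symm

end Analytic

/-! ## Eq. (99): `τ(n)T_n(ρ) = λ(n)²(1−λ(n)²)⁻¹ C_n(ρ)` with `C_n` written through `ξ_n^{an}` -/

section NinetyNine

/-- **CC's `C_n(ρ)` of eq. (99)** in tree normalisation (`ψ_n^{an} = ξ_n^{an}/√2`, so the printed
`C_n`, built from `ξ_n^{an}`, is `2×` the same bracket built from `ψ_n^{an}`):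
`C_n(ρ) = 2·[ρ^{1/2}∫_{ρ⁻¹}^1 x(ψ^{an})′(x)·ρx(ψ^{an})′(ρx)dx + ρ^{−3/2}(ψ^{an})′(ρ⁻¹)ψ^{an}(1)
− ρ^{3/2}ψ^{an}(1)(ψ^{an})′(ρ)]`. [cite: ConnesConsani2021, §5 eq. (99) p. 32 (arXiv chunk p0020:L76–L78; LaTeX label sonineQbis)] -/
def sonineCTerm (n : ℕ) (ρ : ℝ) : ℝ :=
  2 * (ρ ^ (1 / 2 : ℝ) * (∫ x in ρ⁻¹..1,
        (x * deriv (prolateFunAn n) x) * (ρ * x * deriv (prolateFunAn n) (ρ * x)))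
    + ρ ^ (-(3 / 2) : ℝ) * deriv (prolateFunAn n) ρ⁻¹ * prolateFunAn n 1
    - ρ ^ (3 / 2 : ℝ) * prolateFunAn n 1 * deriv (prolateFunAn n) ρ)

/-- **Eq. (99) (PROVED)**: for `ρ ≥ 1`, the `n`-th term of (98)/(sonineQ) is
`τ(n)T_n(ρ) = λ(n)²(1−λ(n)²)⁻¹·C_n(ρ)` with `C_n` the `ξ_n^{an}`-expression of (99): substitute
`η̃_n = λ(n)ψ_n^{an}` (`cosTransform_prolateFun_eq_mul_prolateFunAn`, on `[1,∞)` and at `1`), `D_uη̃_n = λ(n)·y(ψ_n^{an})′`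
and `D_uψ_n = x(ψ_n^{an})′` on `[ρ⁻¹,1] ⊂ (0,1]` into `sonineQTerm`, and `D_u f(x) = xf′(x)`,
`ρ^{±3/2} = ρ^{±1/2}ρ^{±1}`. [cite: ConnesConsani2021, §5 eq. (99) p. 32 (arXiv chunk p0020:L69–L78; LaTeX label sonineQbis)] -/
theorem sonineQTerm_prolateFun_eq (n : ℕ) {ρ : ℝ} (hρ : 1 ≤ ρ) :
    sonineQTerm (prolateFun n) (prolateEigen n) ρ
      = prolateEigen n ^ 2 / (1 - prolateEigen n ^ 2) * sonineCTerm n ρ := by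
  have hρ0 : 0 < ρ := by linarith
  have hρi0 : 0 < ρ⁻¹ := inv_pos.2 hρ0
  have hρi1 : ρ⁻¹ ≤ 1 := inv_le_one_of_one_le₀ hρ
  set lam : ℝ := prolateEigen n with hlam
  set g : ℝ → ℝ := deriv (prolateFunAn n) with hg
  -- powers of `ρ`
  have hs : Real.sqrt ρ = ρ ^ (1 / 2 : ℝ) := Real.sqrt_eq_rpow ρ
  have h32 : ρ ^ (3 / 2 : ℝ) = Real.sqrt ρ * ρ := by
    rw [hs, show (3 / 2 : ℝ) = 1 / 2 + 1 by norm_num, Real.rpow_add hρ0, Real.rpow_one]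
  have hm32 : ρ ^ (-(3 / 2) : ℝ) = (Real.sqrt ρ)⁻¹ * ρ⁻¹ := by
    rw [Real.rpow_neg hρ0.le, h32, mul_inv]
  -- the integrand on `[ρ⁻¹, 1] ⊂ [−1, 1]`
  have hint : ∫ x in ρ⁻¹..1, scaleDerivIn (prolateFun n) x *
        scaleDeriv (cosTransform (prolateFun n)) (ρ * x)
      = lam * ∫ x in ρ⁻¹..1, (x * g x) * (ρ * x * g (ρ * x)) := by
    rw [← intervalIntegral.integral_const_mul]
    refine intervalIntegral.integral_congr fun x hx ↦ ?_
    rw [uIcc_of_le hρi1] at hx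
    have hx' : x ∈ Icc (-1 : ℝ) 1 := ⟨by linarith [hx.1, hρi0.le], hx.2⟩
    rw [scaleDerivIn_prolateFun_eq hx', scaleDeriv_cosTransform_prolateFun_eq]
    simp only [hg]; ring
  have hone : (1 : ℝ) ∈ Icc (-1 : ℝ) 1 := ⟨by norm_num, le_rfl⟩
  rw [sonineQTerm, hint, scaleDerivIn_prolateFun_eq ⟨by linarith, hρi1⟩,
    cosTransform_prolateFun_eq_mul_prolateFunAn n 1, scaleDeriv_cosTransform_prolateFun_eq n ρ,
    ← prolateFunAn_one n, sonineCTerm, h32, hm32, ← hs]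
  simp only [hg, hlam]
  have h1l : (1 : ℝ) - prolateEigen n ^ 2 ≠ 0 := by
    have h := abs_prolateEigen_lt_one n
    have h0 := abs_nonneg (prolateEigen n)
    nlinarith [sq_abs (prolateEigen n)]
  field_simp
  ring

end NinetyNine

/-! ## The Frobenius series at `x = 1` continues `ψ_n` past the band edge (certificate hook) -/

section Frobenius

/-- **`η̃_k = λ(k)·C_b·u_b` on `[1,3)`** — the continuation identity instantiated on the tree's
principal Frobenius solution `u_b = frobSol 1 b` (`ProlateFrobenius.lean`: the power series at the
regular-singular point `x = 1`, radius `2`, `u_b(1) = 1`) at a CRITICAL parameter `b`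
(`u_b′(0) = 0`) with `k` zeros in `(0,1)`, where `ψ_k = C_b·u_b(|·|)` on `[−1,1]`
(`prolateFun_eq_frobEvenExt`, `C_b = frobNormConst b`): for `1 ≤ y < 3`,
`cosTransform ψ_k (y) = λ(k)·C_b·u_b(y)`.  This is the outer-argument input (`ρx ∈ [1,2]`) of a
kernel certificate for the terms `C_n(ρ)` of (99).
[cite: ConnesConsani2021, §5 p. 32, text before eq. (99) (arXiv chunk p0020:L69–L72); CoddingtonLevinson1955, Ch. 4 §8] -/
theorem cosTransform_prolateFun_eq_mul_frobSol {b : ℝ} {k : ℕ} (hB : frobSol₁ 1 b 0 = 0)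
    (hN : {x | x ∈ Ioo (0 : ℝ) 1 ∧ frobSol 1 b x = 0}.ncard = k) {y : ℝ} (hy : y ∈ Ico (1 : ℝ) 3) :
    cosTransform (prolateFun k) y = prolateEigen k * (frobNormConst b * frobSol 1 b y) := by
  -- the eigen-equation of `ψ_k` has `χ = b`
  have hχ : ∀ x ∈ Ioo (-1 : ℝ) 1,
      -(deriv (fun y ↦ (1 ^ 2 - y ^ 2) * deriv (prolateFun k) y) x)
        + (2 * π * 1 * x) ^ 2 * prolateFun k x = b * prolateFun k x := by
    rw [prolateFun_eq_frobEvenExt hB hN]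
    exact (isProlateFunction_frobEvenExt hB hN).2
  -- work on `[1, b']` with `y < b' < 3`
  set b' : ℝ := (y + 3) / 2 with hb'
  have hyb : y < b' := by rw [hb']; linarith [hy.2]
  have hb3 : b' < 3 := by rw [hb']; linarith [hy.2]
  have hb1 : 1 < b' := lt_of_le_of_lt hy.1 hyb
  have hmem : ∀ x ∈ Icc 1 b', |1 - x| < 2 * 1 := fun x hx ↦
    abs_lt.mpr ⟨by linarith [hx.2], by linarith [hx.1]⟩
  set C : ℝ := frobNormConst b with hC
  have hd : ∀ x ∈ Icc 1 b', HasDerivAt (fun t ↦ C * frobSol 1 b t) (C * frobSol₁ 1 b x) x :=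
    fun x hx ↦ (hasDerivAt_frobSol one_pos b (hmem x hx)).const_mul C
  have hd₁ : ∀ x ∈ Icc 1 b', HasDerivAt (fun t ↦ C * frobSol₁ 1 b t) (C * frobSol₂ 1 b x) x :=
    fun x hx ↦ (hasDerivAt_frobSol₁ one_pos b (hmem x hx)).const_mul C
  have huc : ContinuousOn (fun t ↦ C * frobSol 1 b t) (Icc 1 b') :=
    fun x hx ↦ (hd x hx).continuousAt.continuousWithinAt
  have hode : ∀ x ∈ Ioo 1 b', (1 - x ^ 2) * (C * frobSol₂ 1 b x)
      = 2 * x * (C * frobSol₁ 1 b x) + ((2 * π * x) ^ 2 - b) * (C * frobSol 1 b x) := by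
    intro x hx
    linear_combination C * frobSol_ode one_pos b (hmem x (Ioo_subset_Icc_self hx))
  have hB' : ∃ B, ∀ x ∈ Ioo 1 b', |C * frobSol₁ 1 b x| ≤ B := by
    obtain ⟨B, hB⟩ := isCompact_Icc.exists_bound_of_continuousOn
      (fun x hx ↦ (hd₁ x hx).continuousAt.continuousWithinAt :
        ContinuousOn (fun t ↦ C * frobSol₁ 1 b t) (Icc 1 b'))
    exact ⟨B, fun x hx ↦ by simpa [Real.norm_eq_abs] using hB x (Ioo_subset_Icc_self hx)⟩
  have h1 : C * frobSol 1 b 1 = prolateFun k 1 := by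
    rw [frobSol_self, mul_one, prolateFun_eq_frobEvenExt hB hN, hC]
    simp [frobEvenExt]
  exact cosTransform_prolateFun_eq_mul_of_ode hχ hb1 huc (fun x hx ↦ hd x (Ioo_subset_Icc_self hx))
    (fun x hx ↦ hd₁ x (Ioo_subset_Icc_self hx)) hode hB' h1 y ⟨hy.1, hyb.le⟩

/-- **`ψ_k^{an} = C_b·u_b` on `(−1, 3)`**: the analytic continuation `prolateFunAn k` IS the
normalised principal Frobenius series on its whole disc of convergence — on `[1,3)` by the
continuation identity, on `[0,1]` by `ψ_k = C_b u_b` there, on `(−1,0)` by evenness of both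
(`prolateFunAn_neg`, `frobSol_neg_eq`).
[cite: ConnesConsani2021, §5 p. 32, text before eq. (99); CoddingtonLevinson1955, Ch. 4 §8] -/
theorem prolateFunAn_eq_frobNormConst_mul_frobSol {b : ℝ} {k : ℕ} (hB : frobSol₁ 1 b 0 = 0)
    (hN : {x | x ∈ Ioo (0 : ℝ) 1 ∧ frobSol 1 b x = 0}.ncard = k) {y : ℝ}
    (hy : y ∈ Ioo (-1 : ℝ) 3) : prolateFunAn k y = frobNormConst b * frobSol 1 b y := by
  rcases le_or_gt 1 y with h1y | hy1
  · -- `[1, 3)`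
    have h := cosTransform_prolateFun_eq_mul_frobSol hB hN ⟨h1y, hy.2⟩
    rw [cosTransform_prolateFun_eq_mul_prolateFunAn] at h
    exact mul_left_cancel₀ (prolateEigen_ne_zero k) h
  · -- `(−1, 1)`: `ψ_k^{an} = ψ_k = C_b u_b(|y|) = C_b u_b(y)`
    have hyI : y ∈ Icc (-1 : ℝ) 1 := ⟨hy.1.le, hy1.le⟩
    rw [prolateFunAn_eq_prolateFun hyI, prolateFun_eq_frobEvenExt hB hN, frobEvenExt,
      if_pos (abs_le.mpr ⟨by linarith [hy.1], hy1.le⟩)]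
    rcases le_or_gt 0 y with hy0 | hy0
    · rw [abs_of_nonneg hy0]
    · rw [abs_of_neg hy0, frobSol_neg_eq one_pos hB ⟨hy.1, hy1⟩]

end Frobenius

end Literature.NumberTheory.ConnesConsani2021

end
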